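import Literature.MathematicalPhysics.QuantumFieldTheory.Balaban1983to89.B6Hprime2132HolderKernel
import Literature.MathematicalPhysics.QuantumFieldTheory.Balaban1983to89.B5Hk163TorusHolder

/-!
# `Balaban1983to89.B6Hprime2132Torus` — T. Bałaban, *Propagators and renormalization transformations for lattice gauge
# theories. II*, Commun. Math. Phys. **96** (1984) 223–250 [Balaban1984PropagatorsII]: `H′_j` of (2.101)/(2.132) AS A
# TYPED TORUS OPERATOR — `Q′_jH′_j = I`, the momentum representation (2.132) as a theorem, the kernel of `H′_j` and of
# its fine derivatives `∂_{ν₁}⋯∂_{ν_m}H′_j` (`m ≤ 3`) = the torus kernels of the fine-offset multipliers, their uniform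
# exponential decay and their local Hölder quotients (p. 246)

statement-level skeleton of published theorems with citation tags; proofs where landed; nothing here is a claim about the Yang–Mills mass gap

PDF held: `paper:balaban1984-cmp96-propagators-rt-ii` (journal page = PDF page + 222); pp. 241, 246 [PDF 19, 24] read AS
IMAGES on the ×2 renders `run/shared/lean/pub/pub-balaban/b2b-balaban-ref1/pages/1984-cmp96-propagators-rt-II/…-p019-x2.png`,
`…-p024-x2.png`.

CITATION HEADER (lean-in-tree rule).  WHAT IS REPRODUCED: lit-balaban SKELETON rows **B6.Eq2.98** (p. 241, (2.101)
*"λ = Δ⁻²Q′_j*(Q′_jΔ⁻²Q′_j*)⁻¹μ, μ = Q′_jλ … Let us denote the operator in (2.101) by H′_j, so λ = H′_jμ. From the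
momentum representation of (2.101) we may get easily that H′_j is a bounded operator with an exponential decay, the bound
and decay rate depending on d only"*, and, same page, *"where the equality Q′_jλ = Q′_jH′_jμ = μ was used"*) and
**B6.Eq2.132** (p. 246, the momentum representation *"(H′_jμ)~(p′+l) = ū_j(p′+l)/Δ²(p′+l) · (Σ_{l′}|u_j(p′+l′)|²/Δ²(p′+l′))⁻¹
μ̃(p′) (2.132)"* and the sentence after it: *"This representation together with the analyticity method described in [3]
imply that derivatives of H′_j up to third order, and their local Hölder norms as in (2.67), are uniformly bounded and have a
uniform exponential decay with a decay rate depending on d only."*).  Until now the tree certified these at SYMBOL / LATTICE-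
KERNEL level only (`…B6Hprime2101`: the multipliers `hP`/`hPrinted`, the symbol identity behind «Q′_jH′_jμ = μ», the
kernel decay of the fine-offset multipliers `GH`; `…B6Hprime2132Holder` (r03 g4): the derivative multipliers `GHD`, `m ≤ 3`,
and their kernel decay; `…B6Hprime2132HolderKernel` (r03 g6): the Hölder-quotient kernels) — with the honest-scope clause
«no operator on ℓ²/on the torus is typed».  THIS FILE removes that clause on the finite tori of the cell's b05 model, by
the pattern of `…B5Hk163Torus` / `…B5Hk163TorusHolder` (the typed `H_k` of paper I, row B5.Claim@28): the TYPED operator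
`H′_j` from unit-lattice scalar functions `μ : T₁ → ℂ` to fine-lattice scalar functions `T_η → ℂ`, its momentum
representation, `Q′_jH′_j = I` as an identity of typed operators, and the identification of its kernel — and of the kernels
of its iterated fine forward differences — with the torus kernels of the multipliers, whence decay and Hölder quotients BY
NAME.  Unit `lit-balaban-r03` (B6 reader/typer and fold owner, gen 6), PHASE 2 (G.1), HOME `run/shared/lean/pub/lit-balaban/`,
2026-08-21.  IMPORTS `…B6Hprime2132HolderKernel` (hence `…B6Hprime2132Holder`, `…B6Hprime2101`, the b04 engine) and
`…B5Hk163TorusHolder` (hence `…B5Hk163Torus`, `…B5Block118`: the torus model, `QsOp` = Q′, `dft_QsOp` = (1.30), the DFT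
bookkeeping lemmas) — everything BY NAME; nothing of the tree is restated; no new named fact.

## Typed reading (the torus model of the b05 lineage; ours, not a printed display)

Coarse (unit) torus `T₁ = Π_ν ℤ/M_ν` (`B5Prop11Plancherel.Tor M`) — the lattice on which `μ` lives (paper II's unit lattice
`T^{(j)}_1` after the rescaling of Sect. C); fine torus `T_η = Π_ν ℤ/(nM_ν)` (`Tor (fine n M)`, `η = ξ = L^{−j} = 1/n`); the
scalar block average `Q′ = B5Block118.QsOp n M` (*"(Q′_kλ)(y) = Σ_{x∈B^k(y)} η^dλ(x)"*, B5 p. 20; its momentum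
representation `B5Block118.dft_QsOp` = B5 (1.30) `(Q′f)^(p′) = c Σ_l u(p′+l) f^(p′+l)`); momenta `p′ + l` = `pOf n M (l, p′)`,
`p′ = sOf M q ∈ (−π, π]^d`.  The multiplier of `H′_j` at the alias `l = 2πk` is the regrouped `h′_l(p′) = B6Hprime2101.hP n k p′`
(= the printed (2.132) bracket `hPrinted` wherever `Δ(p′) ≠ 0`, `B6Hprime2101.hP_eq_printed` — i.e. at every torus momentum
`p′ ≠ 0`; at `p′ = 0` the regrouped symbol takes the limiting values `h′_0(0) = 1`, `h′_l(0) = 0`).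

## Content (sorry-free; every `[cite: …]` tag is a TEXT LOCATION; the mathematics is `[folklore]` Fourier bookkeeping)

* §1 `qk_hP_torus`: `Σ_l u(p′+l) h′_l(p′) = 1` at EVERY torus momentum (zero mode included) — `B6Hprime2101.sum_uSym_mul_hP`.
* §2 THE TYPED OPERATOR `HpOp n M : Matrix (Tor (fine n M)) (Tor M) ℂ` with kernel
  `hker x′ y = |T₁|⁻¹ Σ_{(l,p′)} e^{i(p′+l)·x′} e^{−ip′·y} h′_l(p′)`; `HpOp_mulVec_eq_2132` (position-space form);
  **`dft_HpOp`**: `(H′_jμ)^(p′+l) = c⁻¹ · h′_l(p′) · μ̂(p′)`, `c = B5Block118.cQ` — the momentum representation (2.132) AS A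
  THEOREM about the typed operator (unitary DFT pair of `B5Prop11Plancherel`; normalisation ours), and `dft_HpOp_printed`: the
  same with the LITERAL printed bracket `hPrinted` at every `p′ ≠ 0`; **`QsOp_HpOp_mulVec` / `QsOp_mul_HpOp`: `Q′_jH′_jμ = μ`,
  `Q′_jH′_j = 1`** (p. 241) from `dft_QsOp` + `dft_HpOp` + §1 + injectivity of the DFT; the dictionary `hker_bpt`: the kernel
  from the coarse point `y` to the fine point `n·y′ + a` is `gker a (y′ − y) = |T₁|⁻¹Σ_{p′}e^{ip′(y′−y)}G′_a(p′)`,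
  `G′_a = B6Hprime2101.GH n a`.
* §3 (dimension written `d + 1 ≥ 1`, as in the engine) `gker_toT_eq_torusKernel`: `gker a x̄ = B4TorusKernel.MultiPeriod.torusKernel
  (descendC G′_a) M x`; **`norm_HpOp_le`**: `|H′_j(n·x̄′ + a, x̄)| ≤ MGH(d+1)·periodConst(κ_N(d+1), d)·e^{−(κ_N(d+1)/(d+1))|x′−x|_{T,∞}}`
  for every period vector, every `n ≥ 1`, every fine offset `a` (*"H′_j is a bounded operator with an exponential decay, the
  bound and decay rate depending on d only"*, p. 241; `B6Hprime2101.torusKernel_GH_decay` BY NAME); `norm_HpOp_mulVec_le`.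
* §4 THE DERIVATIVES OF THE TYPED OPERATOR: `iterD m νs f = ∂_{ν₀}(∂_{ν₁}(⋯∂_{ν_{m−1}} f))`, the iterated fine forward
  differences `B5Action121.sdiff (fine n M) n ν` (factor `η⁻¹ = n`, B5 (1.4)); `iterD_kernel` (linearity);
  `dker νs x′ y = |T₁|⁻¹ Σ e^{i(p′+l)x′} Π_i∂_{ν_i}(p′+l) e^{−ip′y} h′_l(p′)` and **`iterD_hker`**: the kernel of
  `∂_{ν₀}⋯∂_{ν_{m−1}}H′_j` IS `dker` (each difference multiplies the alias `(l, p′)` by `∂_ν(p′+l) = n(e^{iη(p′+l)_ν} − 1)`,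
  `B5Hk163TorusHolder.chi_pOf_unitVec`); `iterD_HpOp_mulVec`; the dictionary `dker_bpt` / `gkerD_toT_eq_torusKernel`: the
  derivative kernel from `y` to `n·y′ + a` is the torus kernel of `B6Hprime2132Holder.GHD n a νs`; hence, for `m ≤ 3`,
  **`norm_dker_le`** (*"derivatives of H′_j up to third order … uniformly bounded and have a uniform exponential decay with a
  decay rate depending on d only"*: `≤ MGHD(d+1,m)·periodConst·e^{−(κ_N(d+1)/(d+1))|x′−x|_{T,∞}}`, `B6Hprime2132Holder.torusKernel_GHD_decay`
  BY NAME) and **`norm_dker_sub_le`** (*"and their local Hölder norms as in (2.67)"*: for two fine points `n·x̄′ + a`,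
  `n·x̄′ + ã` of the same unit cube with `|a_ν − ã_ν| ≤ δ` and `0 ≤ α < 1`,
  `|∂^mH′_j(n·x̄′+a, x̄) − ∂^mH′_j(n·x̄′+ã, x̄)| ≤ 2e^{d+2}(d+2)C′(d+1,m,α)(δ/n)^α·periodConst·e^{−(κ_N(d+1)/(d+1))|x′−x|_{T,∞}}`,
  `B6Hprime2132HolderKernel.torusKernel_GHD_holder` BY NAME); operator forms `norm_iterD_HpOp_mulVec_le`,
  `norm_iterD_HpOp_mulVec_sub_le`.

## Honest scope

(i) TORUS MODEL ONLY (finite periodic lattices), as in the whole b05 lineage and in `…B5Hk163Torus`; the infinite-lattice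
statements are the `latticeKernel` forms of the three imported files.  (ii) `H′_j` is typed by its momentum representation
(2.132) (the paper DEFINES `H′_j` by (2.101) and derives (2.132) — *"the momentum representation obtained from (2.101)"*; the
operator algebra (2.101) ⇒ (2.132), i.e. the identification of `HpOp` with `Δ⁻²Q′*(Q′Δ⁻²Q′*)⁻¹` built from typed `Δ`, `Q′*`,
is NOT claimed here: only `Q′_jH′_j = 1` is certified as an identity of typed operators, exactly as `…B5Hk163Torus` certifies
`Q_kH_k = I`).  (iii) The derivative / Hölder statements are KERNEL-ENTRY bounds at the fine points `n·x̄′ + a` (every fine point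
of the block of `x̄′`; that the blocks partition the fine torus is not used), the two Hölder points in the same block; constants
(`MGH`, `MGHD`, `CHolder2132`, `κ_N`, `periodConst`) ours, crude, dimension/order/exponent-only, diverging as `α → 1`; orders
`m ≥ 4` not claimed (not printed).  (iv) Value = kernel certificate of bookkeeping for a located, asserted step of
[Balaban1984PropagatorsII]; NOT summit progress, NOT continuum, NOT Clay.
-/

open scoped BigOperators Matrix ComplexConjugate Real
open Finset Complex

namespace Literature.MathematicalPhysics.QuantumFieldTheory.Balaban1983to89.B6Hprime2132Torus

open Literature.MathematicalPhysics.QuantumFieldTheory.Balaban1983to89.B4Strip (ofRealVec shift Strip DeltaXi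
  DeltaXir DeltaXi_ofReal)
open Literature.MathematicalPhysics.QuantumFieldTheory.Balaban1983to89.B4ContourShift (BZ StripRegular)
open Literature.MathematicalPhysics.QuantumFieldTheory.Balaban1983to89.B4TorusKernel (descendC descendC_apply
  face_match rep_mem periodConst)
open Literature.MathematicalPhysics.QuantumFieldTheory.Balaban1983to89.B4TorusKernel.MultiPeriod (gridPt torusSum
  torusKernel torusSupNorm)
open Literature.MathematicalPhysics.QuantumFieldTheory.Balaban1983to89.B5Prop11Plancherel (Tor chi dft fine sOf
  unitVec conj_chi chi_add_right abs_sOf_le sOf_ne_zero dft_mem_unitaryGroup)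
open Literature.MathematicalPhysics.QuantumFieldTheory.Balaban1983to89.B5Prop11Fiber (uSym dSym)
open Literature.MathematicalPhysics.QuantumFieldTheory.Balaban1983to89.B5Prop11Leaves (DeltaXir_pos)
open Literature.MathematicalPhysics.QuantumFieldTheory.Balaban1983to89.B5Action121 (sdiff sdiff_mulVec)
open Literature.MathematicalPhysics.QuantumFieldTheory.Balaban1983to89.B5Block118 (cT dft_apply'
  sum_conj_chi_mul_chi up iota bpt pOf pOf_injective om chi_pOf_up chi_pOf_iota QsOp dft_QsOp cQ dSym_eq_om)
open Literature.MathematicalPhysics.QuantumFieldTheory.Balaban1983to89.B5Constraint130 (cQ_ne_zero)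
open Literature.MathematicalPhysics.QuantumFieldTheory.Balaban1983to89.B5Hk163Strip (dC dC_ofReal kappaN kappaN_pos
  shift_ofRealVec_apply)
open Literature.MathematicalPhysics.QuantumFieldTheory.Balaban1983to89.B5Hk163Decay (phase163)
open Literature.MathematicalPhysics.QuantumFieldTheory.Balaban1983to89.B5Kernel166Decay (torFin card_Tor_cast
  toT_sub chi_toT_eq_mFourier two_pi_rep_grid chi_neg_comm)
open Literature.MathematicalPhysics.QuantumFieldTheory.Balaban1983to89.B5Hk163Torus (sum_conj_chi_pOf const_eq163
  dft_mulVec_injective phase163_sOf)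
open Literature.MathematicalPhysics.QuantumFieldTheory.Balaban1983to89.B5Hk163TorusHolder (chi_pOf_unitVec sOf_mem_BZ)
open Literature.MathematicalPhysics.QuantumFieldTheory.Balaban1983to89.B6LowerBound2153Torus (toT)
open Literature.MathematicalPhysics.QuantumFieldTheory.Balaban1983to89.B6Cov2156Torus (one_le_M)
open Literature.MathematicalPhysics.QuantumFieldTheory.Balaban1983to89.B6Hprime2101 (hP hPrinted hP_eq_printed
  sum_uSym_mul_hP GH MGH stripRegular_GH torusKernel_GH_decay)
open Literature.MathematicalPhysics.QuantumFieldTheory.Balaban1983to89.B6Hprime2132Holder (GHD MGHD CHolder2132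
  stripRegular_GHD torusKernel_GHD_decay)
open Literature.MathematicalPhysics.QuantumFieldTheory.Balaban1983to89.B6Hprime2132HolderKernel (stripRegular_GHD_sub
  torusKernel_GHD_holder)

noncomputable section

variable {d : ℕ}

/-! ## §1. `Σ_l u(p′+l) h′_l(p′) = 1` at every torus momentum (the symbol identity behind «Q′_jH′_jμ = μ») -/

section Symbol

variable (n : ℕ) [NeZero n] (M : Fin d → ℕ) [hM : ∀ μ, NeZero (M μ)]

/-- **`Σ_{l ∈ 2π{0..n−1}^d} u(p′+l) h′_l(p′) = 1` AT EVERY TORUS MOMENTUM `p′ = sOf M q`**, the zero mode `q = 0` included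
(`B6Hprime2101.sum_uSym_mul_hP`, valid on the whole closed Brillouin zone since `𝒩(p′) ≠ 0` there).
[cite: Balaban1984PropagatorsII, p.241 «where the equality Q′_jλ = Q′_jH′_jμ = μ was used»] [folklore] -/
theorem qk_hP_torus (q : Tor M) :
    ∑ k : Fin d → Fin n, uSym n k (sOf M q) * hP n k (ofRealVec (sOf M q)) = 1 :=
  sum_uSym_mul_hP n (sOf M q) (abs_sOf_le M q)

end Symbol

/-! ## §2. The typed torus operator `H′_j`, its momentum representation (2.132), and `Q′_jH′_j = I` -/

section Operator

variable (n : ℕ) [NeZero n] (M : Fin d → ℕ) [hM : ∀ μ, NeZero (M μ)]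

/-- THE POSITION-SPACE TORUS KERNEL OF THE (2.132) MULTIPLIER (our inverse-DFT reading of the printed momentum display):
`hker x′ y = |T₁|⁻¹ Σ_{(l,p′)} e^{i(p′+l)·x′} e^{−ip′·y} h′_l(p′)` (fine point `x′ ∈ T_η`, coarse point `y ∈ T₁`).
[cite: Balaban1984PropagatorsII, (2.132) p.246 (momentum display; position-space torus reading and normalisation ours)] [folklore] -/
def hker (x : Tor (fine n M)) (y : Tor M) : ℂ :=
  ((Fintype.card (Tor M) : ℂ))⁻¹ *
    ∑ kq : (Fin d → Fin n) × Tor M,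
      chi (fine n M) (pOf n M kq) x * conj (chi M kq.2 y) * hP n kq.1 (ofRealVec (sOf M kq.2))

/-- **THE TYPED OPERATOR `H′_j`** from unit-lattice (coarse) scalar functions `μ : T₁ → ℂ` to fine-lattice scalar functions
`λ = H′_jμ : T_η → ℂ`, as a matrix: `H′_j(x′, y) = hker x′ y`.
[cite: Balaban1984PropagatorsII, (2.101) p.241 «Let us denote the operator in (2.101) by H′_j, so λ = H′_jμ»; (2.132) p.246 (momentum display)] [folklore] -/
def HpOp : Matrix (Tor (fine n M)) (Tor M) ℂ :=
  fun x y => hker n M x y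

/-- `(H′_jμ)(x′) = Σ_y hker x′ y · μ(y)`. [cite: Balaban1984PropagatorsII, (2.132) p.246 (position-space torus reading ours)] [folklore] -/
theorem HpOp_mulVec (μf : Tor M → ℂ) (x : Tor (fine n M)) :
    (HpOp n M *ᵥ μf) x = ∑ y : Tor M, hker n M x y * μf y := by
  simp only [Matrix.mulVec, dotProduct, HpOp]

/-- the un-normalised unit-lattice transform `μ̃(p′) = Σ_y e^{−ip′·y} μ(y)` (our normalisation of the `μ̃` of (2.132)). [folklore] -/
def tildeMu (μf : Tor M → ℂ) (q : Tor M) : ℂ := ∑ y, conj (chi M q y) * μf y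

/-- **THE POSITION-SPACE FORM ON THE TORUS**: `(H′_jμ)(x′) = |T₁|⁻¹ Σ_{p′} Σ_l e^{i(p′+l)·x′} h′_l(p′) μ̃(p′)` — the inverse
fine-lattice transform (momenta `p′ + l`) of the momentum display (2.132); reading and normalisation ours.
[cite: Balaban1984PropagatorsII, (2.132) p.246 (momentum display)] [folklore] -/
theorem HpOp_mulVec_eq_2132 (μf : Tor M → ℂ) (x : Tor (fine n M)) :
    (HpOp n M *ᵥ μf) x = ((Fintype.card (Tor M) : ℂ))⁻¹ * ∑ kq : (Fin d → Fin n) × Tor M,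
        chi (fine n M) (pOf n M kq) x * (hP n kq.1 (ofRealVec (sOf M kq.2)) * tildeMu M μf kq.2) := by
  rw [HpOp_mulVec]
  simp only [hker, tildeMu, Finset.mul_sum, Finset.sum_mul]
  rw [Finset.sum_comm]
  refine Finset.sum_congr rfl fun kq _ => Finset.sum_congr rfl fun y _ => ?_
  ring

/-- the fine DFT row at `p = p′ + l` against the kernel: only the alias `(l, p′)` itself survives,
`Σ_{x′} F^η_{p,x′} hker x′ y = |T_η|^{1/2}|T₁|⁻¹ e^{−ip′·y} h′_l(p′)`. [folklore] -/
private theorem sum_dft_mul_hker (k : Fin d → Fin n) (q : Tor M) (y : Tor M) :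
    ∑ x, dft (fine n M) (pOf n M (k, q)) x * hker n M x y
      = (cT (fine n M) : ℂ) * (Fintype.card (Tor (fine n M)) : ℂ) * ((Fintype.card (Tor M) : ℂ))⁻¹
        * (conj (chi M q y) * hP n k (ofRealVec (sOf M q))) := by
  have hx : ∀ x, dft (fine n M) (pOf n M (k, q)) x * hker n M x y
      = (cT (fine n M) : ℂ) * ((Fintype.card (Tor M) : ℂ))⁻¹ *
        ∑ kq : (Fin d → Fin n) × Tor M,
          (conj (chi M kq.2 y) * hP n kq.1 (ofRealVec (sOf M kq.2))) *
          (conj (chi (fine n M) (pOf n M (k, q)) x) * chi (fine n M) (pOf n M kq) x) := by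
    intro x
    rw [dft_apply', hker]
    simp only [Finset.mul_sum]
    refine Finset.sum_congr rfl fun kq _ => ?_
    ring
  simp_rw [hx]
  rw [← Finset.mul_sum, Finset.sum_comm]
  simp_rw [← Finset.mul_sum, sum_conj_chi_pOf, mul_ite, mul_zero]
  rw [Finset.sum_ite_eq' Finset.univ (k, q), if_pos (Finset.mem_univ _)]
  ring

/-- **THE MOMENTUM REPRESENTATION OF THE TYPED `H′_j` = (2.132)** (unitary DFT pair of `B5Prop11Plancherel`):
`(H′_jμ)^(p′+l) = c⁻¹ · h′_l(p′) · μ̂(p′)`, `c = B5Block118.cQ n M = (√(n^d))⁻¹`, with the regrouped bracket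
`h′_l = B6Hprime2101.hP` — the printed display *"(H′_jμ)~(p′+l) = [ū_j(p′+l)/Δ²(p′+l)·(Σ_{l′}|u_j(p′+l′)|²/Δ²(p′+l′))⁻¹] μ̃(p′)"*
up to our normalisation `c⁻¹`, at EVERY torus momentum. [cite: Balaban1984PropagatorsII, (2.132) p.246] [folklore] -/
theorem dft_HpOp (μf : Tor M → ℂ) (k : Fin d → Fin n) (q : Tor M) :
    (dft (fine n M) *ᵥ (HpOp n M *ᵥ μf)) (pOf n M (k, q))
      = ((cQ n M : ℂ))⁻¹ * hP n k (ofRealVec (sOf M q)) * (dft M *ᵥ μf) q := by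
  have hL : (dft (fine n M) *ᵥ (HpOp n M *ᵥ μf)) (pOf n M (k, q))
      = ∑ y, μf y * ∑ x, dft (fine n M) (pOf n M (k, q)) x * hker n M x y := by
    simp only [Matrix.mulVec, dotProduct, HpOp]
    simp_rw [Finset.mul_sum]
    rw [Finset.sum_comm]
    refine Finset.sum_congr rfl fun y _ => Finset.sum_congr rfl fun x _ => ?_
    ring
  rw [hL]
  simp_rw [sum_dft_mul_hker, const_eq163]
  simp only [Matrix.mulVec, dotProduct, dft_apply']
  rw [Finset.mul_sum]
  refine Finset.sum_congr rfl fun y _ => ?_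
  ring

/-- at a NON-ZERO torus momentum the fine Laplace symbol does not vanish: `Δ(p′) ≠ 0` for `p′ = sOf M q`, `q ≠ 0`. [folklore] -/
private theorem DeltaXi_sOf_ne_zero {q : Tor M} (hq : q ≠ 0) : DeltaXi n 0 (ofRealVec (sOf M q)) ≠ (0 : ℂ) := by
  have hn : 1 ≤ n := Nat.one_le_iff_ne_zero.mpr (NeZero.ne n)
  obtain ⟨ν, hν⟩ := Function.ne_iff.mp (sOf_ne_zero M hq)
  have hpos : 0 < DeltaXir n 0 (sOf M q) := DeltaXir_pos n hn (sOf M q) (abs_sOf_le M q) ν hν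
  rw [DeltaXi_ofReal]
  exact_mod_cast hpos.ne'

/-- **(2.132) WITH THE LITERAL PRINTED BRACKET** at every non-zero torus momentum (*"μ orthogonal to constant functions"*,
p. 241, excludes `p′ = 0`): `(H′_jμ)^(p′+l) = c⁻¹ · [ū(p′+l)Δ(p′+l)⁻²(Σ_{l′}|u(p′+l′)|²Δ(p′+l′)⁻²)⁻¹] · μ̂(p′)`
(`B6Hprime2101.hPrinted`, `hP_eq_printed`). [cite: Balaban1984PropagatorsII, (2.132) p.246; (2.101) p.241] [folklore] -/
theorem dft_HpOp_printed (μf : Tor M → ℂ) (k : Fin d → Fin n) {q : Tor M} (hq : q ≠ 0) :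
    (dft (fine n M) *ᵥ (HpOp n M *ᵥ μf)) (pOf n M (k, q))
      = ((cQ n M : ℂ))⁻¹ * hPrinted n k (ofRealVec (sOf M q)) * (dft M *ᵥ μf) q := by
  rw [dft_HpOp, hP_eq_printed n (DeltaXi_sOf_ne_zero n M hq) k]

/-- **`Q′_jH′_jμ = μ` FOR THE TYPED TORUS OPERATORS** `Q′ = B5Block118.QsOp` (momentum representation B5 (1.30) =
`dft_QsOp`) and `H′_j = HpOp` ((2.132)): in momentum space `(Q′H′μ)^(p′) = cΣ_l u(p′+l)·c⁻¹h′_l(p′)μ̂(p′) = [Σ_l u h′_l]μ̂(p′)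
= μ̂(p′)` by §1 at EVERY `p′` (zero mode included), and the unitary DFT is injective.
[cite: Balaban1984PropagatorsII, p.241 «where the equality Q′_jλ = Q′_jH′_jμ = μ was used»] [folklore] -/
theorem QsOp_HpOp_mulVec (μf : Tor M → ℂ) : QsOp n M *ᵥ (HpOp n M *ᵥ μf) = μf := by
  have hcQ := cQ_ne_zero n M
  apply dft_mulVec_injective M
  funext q
  show (dft M *ᵥ (QsOp n M *ᵥ (HpOp n M *ᵥ μf))) q = (dft M *ᵥ μf) q
  rw [dft_QsOp]
  simp_rw [dft_HpOp]
  have h : ∑ k : Fin d → Fin n, uSym n k (sOf M q) *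
        (((cQ n M : ℂ))⁻¹ * hP n k (ofRealVec (sOf M q)) * (dft M *ᵥ μf) q)
      = ((cQ n M : ℂ))⁻¹ * (dft M *ᵥ μf) q *
          ∑ k : Fin d → Fin n, uSym n k (sOf M q) * hP n k (ofRealVec (sOf M q)) := by
    rw [Finset.mul_sum]
    refine Finset.sum_congr rfl fun k _ => ?_
    ring
  rw [h, qk_hP_torus, mul_one, ← mul_assoc, mul_inv_cancel₀ hcQ, one_mul]

/-- **`Q′_jH′_j = 1`** as a product of the typed matrices. [cite: Balaban1984PropagatorsII, p.241 «Q′_jλ = Q′_jH′_jμ = μ»] [folklore] -/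
theorem QsOp_mul_HpOp : QsOp n M * HpOp n M = 1 :=
  Matrix.ext_of_mulVec_single fun i => by
    rw [← Matrix.mulVec_mulVec, QsOp_HpOp_mulVec, Matrix.one_mulVec]

/-- THE KERNEL BETWEEN A BLOCK POINT AND A COARSE POINT as the torus momentum sum of the fine-offset multiplier:
`gker a z = |T₁|⁻¹ Σ_{p′} e^{ip′·z} G′_a(p′)`, `G′_a = B6Hprime2101.GH n a`. [folklore] -/
def gker (a : Fin d → Fin n) (z : Tor M) : ℂ :=
  ((Fintype.card (Tor M) : ℂ))⁻¹ * ∑ q : Tor M, chi M q z * GH n a (ofRealVec (sOf M q))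

/-- **THE DICTIONARY**: the kernel of `H′_j` from the coarse point `y` to the fine point `n·y′ + a` (`bpt y′ a`) is
`gker a (y′ − y)` — `e^{i(p′+l)·(ny′+a)} = e^{ip′·y′}·e^{i(p′+l)·ηa}` (`chi_pOf_up`, `phase163_sOf`), so the `l`-sum produces
`G′_a(p′)` (the torus form of `B6Hprime2101` §3 / `B5Hk163Decay.exp_fine_phase_split`).
[cite: Balaban1984PropagatorsII, (2.132) p.246 (momentum display; torus reading ours, momenta (1.29) of paper I p.23)] [folklore] -/
theorem hker_bpt (y' : Tor M) (a : Fin d → Fin n) (y : Tor M) :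
    hker n M (bpt n M y' a) y = gker n M a (y' - y) := by
  unfold hker gker GH
  congr 1
  rw [Fintype.sum_prod_type, Finset.sum_comm]
  refine Finset.sum_congr rfl fun q _ => ?_
  rw [Finset.mul_sum]
  refine Finset.sum_congr rfl fun k _ => ?_
  dsimp only
  rw [bpt, chi_add_right, chi_pOf_up, ← phase163_sOf, conj_chi, chi_neg_comm, sub_eq_add_neg, chi_add_right]
  ring

end Operator

/-! ## §3. The kernel of `H′_j` is the torus kernel of `G′_a`; exponential decay (dimension `d + 1 ≥ 1`) -/

section Kernel

variable (n : ℕ) [NeZero n] (M : Fin (d + 1) → ℕ) [hM : ∀ μ, NeZero (M μ)]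

/-- face matching of the two momentum conventions on the grid (`2π rep(t/M) ∈ [−π,π)` of the engine versus `sOf ∈ (−π,π]`)
for a strip-regular multiplier (pattern `B5Hk163Torus.G163_grid_eq`).
[cite: Balaban1984PropagatorsI, p.23 (1.29) (the dual torus; dictionary)] [folklore] -/
theorem grid_eq_of_stripRegular {G : (Fin (d + 1) → ℂ) → ℂ} {κ B : ℝ} (hG : StripRegular (d := d) G κ B) (hκ : 0 ≤ κ)
    (t : Tor M) :
    G (ofRealVec (fun i => 2 * Real.pi * B4TorusKernel.rep ((((torFin M t i : ℕ) : ℝ) / M i : ℝ) : UnitAddCircle)))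
      = G (ofRealVec (sOf M t)) := by
  classical
  set u : Fin (d + 1) → ℝ :=
    fun i => 2 * Real.pi * B4TorusKernel.rep ((((torFin M t i : ℕ) : ℝ) / M i : ℝ) : UnitAddCircle) with hu_def
  have hdich : ∀ i, u i = sOf M t i ∨ (u i = -Real.pi ∧ sOf M t i = Real.pi) := fun i => two_pi_rep_grid M t i
  have hu : u ∈ BZ (d + 1) := by
    refine ⟨fun i => ?_, fun i => ?_⟩
    · have h := (rep_mem (((((torFin M t i : ℕ) : ℝ) / M i : ℝ) : UnitAddCircle))).1
      show -Real.pi ≤ 2 * Real.pi * _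
      nlinarith [Real.pi_pos]
    · have h := (rep_mem (((((torFin M t i : ℕ) : ℝ) / M i : ℝ) : UnitAddCircle))).2
      show 2 * Real.pi * _ ≤ Real.pi
      nlinarith [Real.pi_pos]
  have hv : sOf M t ∈ BZ (d + 1) :=
    ⟨fun i => (abs_le.mp (abs_sOf_le M t i)).1, fun i => (abs_le.mp (abs_sOf_le M t i)).2⟩
  refine face_match hG hκ (Finset.univ.filter fun i => u i ≠ sOf M t i) u (sOf M t) hu hv (fun i hi => ?_)
    (fun i hi => ?_)
  · by_contra h
    exact hi (Finset.mem_filter.mpr ⟨Finset.mem_univ _, h⟩)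
  · have h := (Finset.mem_filter.mp hi).2
    rcases hdich i with h' | h'
    · exact absurd h' h
    · exact h'

/-- the torus momentum sum of a strip-regular multiplier at a lattice representative IS the engine's torus kernel:
`|T₁|⁻¹ Σ_q e^{i p′(q)·x̄} G(p′(q)) = B4TorusKernel.MultiPeriod.torusKernel (descendC G) M x`.
[cite: Balaban1984PropagatorsI, p.23 (1.29) with p.36 l.20–23 (torus kernel = periodised lattice kernel; dictionary)] [folklore] -/
theorem momentumSum_toT_eq_torusKernel {G : (Fin (d + 1) → ℂ) → ℂ} {κ B : ℝ} (hG : StripRegular (d := d) G κ B)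
    (hκ : 0 ≤ κ) (x : Fin (d + 1) → ℤ) :
    ((Fintype.card (Tor M) : ℂ))⁻¹ * ∑ q : Tor M, chi M q (toT M x) * G (ofRealVec (sOf M q))
      = torusKernel (descendC G hG hκ) M x := by
  unfold torusKernel torusSum
  rw [card_Tor_cast]
  congr 1
  refine Fintype.sum_equiv (torFin M) _ _ fun t => ?_
  rw [descendC_apply, B4TorusKernel.MultiPeriod.descend_gridPt, chi_toT_eq_mFourier, mul_comm]
  congr 1
  exact (grid_eq_of_stripRegular M hG hκ t).symm

/-- **THE KERNEL OF `H′_j` IS THE TORUS KERNEL OF `G′_a`**: at a lattice representative `x`,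
`gker a x̄ = B4TorusKernel.MultiPeriod.torusKernel (descendC G′_a) M x` (`= Σ_m latticeKernel G′_a (x + Mm)`, the periodised
`ℤ^{d+1}`-Fourier kernel). [cite: Balaban1984PropagatorsII, (2.132) p.246 + p.241 «From the momentum representation of (2.101) …» (torus reading ours)] [folklore] -/
theorem gker_toT_eq_torusKernel (a : Fin (d + 1) → Fin n) (x : Fin (d + 1) → ℤ) :
    gker n M a (toT M x)
      = torusKernel (descendC (fun p : Fin (d + 1) → ℂ => GH n a p)
          (stripRegular_GH n (kappaN_pos _).le le_rfl a) (kappaN_pos _).le) M x :=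
  momentumSum_toT_eq_torusKernel M (stripRegular_GH n (kappaN_pos _).le le_rfl a) (kappaN_pos _).le x

/-- **EXPONENTIAL DECAY OF THE KERNEL OF THE TYPED `H′_j`**, uniformly in the period vector `M` (all `M_i ≥ 1`), in `n ≥ 1`
and in the fine offset `a`: for lattice representatives `x′, x ∈ ℤ^{d+1}`,
`|H′_j(n·x̄′ + a, x̄)| ≤ MGH(d+1) · periodConst(κ_N(d+1), d) · e^{−(κ_N(d+1)/(d+1))|x′ − x|_{T,∞}}` (`B6Hprime2101.torusKernel_GH_decay`
BY NAME; constants dimension-only, ours). [cite: Balaban1984PropagatorsII, p.241 «H′_j is a bounded operator with an exponential decay, the bound and decay rate depending on d only»] [folklore] -/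
theorem norm_HpOp_le (a : Fin (d + 1) → Fin n) (x' x : Fin (d + 1) → ℤ) :
    ‖HpOp n M (bpt n M (toT M x') a) (toT M x)‖
      ≤ MGH (d + 1) * periodConst (kappaN (d + 1)) d *
          Real.exp (-(kappaN (d + 1) / (d + 1) * torusSupNorm M (x' - x))) := by
  show ‖hker n M (bpt n M (toT M x') a) (toT M x)‖ ≤ _
  rw [hker_bpt, toT_sub, gker_toT_eq_torusKernel]
  exact torusKernel_GH_decay n a (one_le_M M) (x' - x)

/-- consequently every `λ = H′_jμ` is bounded pointwise by an exponentially weighted sum of `|μ|`: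
`|(H′_jμ)(n·x̄′ + a)| ≤ MGH·periodConst · Σ_{y ∈ reps} e^{−(κ_N/(d+1))|x′−y|_{T,∞}} |μ(ȳ)|` for any family of lattice
representatives `r : T₁ → ℤ^{d+1}` (`toT ∘ r = id`). [cite: Balaban1984PropagatorsII, p.241 «H′_j is a bounded operator with an exponential decay, the bound and decay rate depending on d only»] [folklore] -/
theorem norm_HpOp_mulVec_le (μf : Tor M → ℂ) (a : Fin (d + 1) → Fin n) (x' : Fin (d + 1) → ℤ)
    (r : Tor M → (Fin (d + 1) → ℤ)) (hr : ∀ y, toT M (r y) = y) :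
    ‖(HpOp n M *ᵥ μf) (bpt n M (toT M x') a)‖
      ≤ MGH (d + 1) * periodConst (kappaN (d + 1)) d *
          ∑ y : Tor M, Real.exp (-(kappaN (d + 1) / (d + 1) * torusSupNorm M (x' - r y))) * ‖μf y‖ := by
  rw [HpOp_mulVec, Finset.mul_sum]
  refine (norm_sum_le _ _).trans (Finset.sum_le_sum fun y _ => ?_)
  rw [norm_mul, ← mul_assoc]
  refine mul_le_mul_of_nonneg_right ?_ (norm_nonneg _)
  have h := norm_HpOp_le n M a x' (r y)
  rw [hr y] at h
  exact h

end Kernel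

/-! ## §4. The fine derivatives `∂_{ν₀}⋯∂_{ν_{m−1}}H′_j` of the typed operator: kernels, decay, local Hölder quotients -/

section Deriv

variable (n : ℕ) [NeZero n] (M : Fin d → ℕ) [hM : ∀ μ, NeZero (M μ)]

/-- THE ITERATED FINE FORWARD DIFFERENCES `∂_{ν₀}(∂_{ν₁}(⋯∂_{ν_{m−1}}f))` of a fine-lattice function, each
`∂_ν = B5Action121.sdiff (fine n M) n ν` (`(∂_νf)(x′) = η⁻¹(f(x′ + ηe_ν) − f(x′))`, B5 (1.4), `η⁻¹ = n`).
[cite: Balaban1984PropagatorsII, p.246 «derivatives of H′_j up to third order» (text only; typing ours)] [folklore] -/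
def iterD : (m : ℕ) → (Fin m → Fin d) → (Tor (fine n M) → ℂ) → (Tor (fine n M) → ℂ)
  | 0, _, f => f
  | m + 1, νs, f => sdiff (fine n M) (n : ℂ) (νs 0) *ᵥ iterD m (Fin.tail νs) f

/-- `iterD 0 = id`. [cite: Balaban1984PropagatorsI, (1.4) p.18 (the forward difference; iteration ours)] [folklore] -/
@[simp] theorem iterD_zero (νs : Fin 0 → Fin d) (f : Tor (fine n M) → ℂ) : iterD n M 0 νs f = f := rfl

/-- `iterD (m+1) νs f = ∂_{ν₀}(iterD m (tail νs) f)`. [cite: Balaban1984PropagatorsI, (1.4) p.18 (the forward difference; iteration ours)] [folklore] -/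
theorem iterD_succ {m : ℕ} (νs : Fin (m + 1) → Fin d) (f : Tor (fine n M) → ℂ) :
    iterD n M (m + 1) νs f = sdiff (fine n M) (n : ℂ) (νs 0) *ᵥ iterD n M m (Fin.tail νs) f := rfl

/-- LINEARITY: the iterated differences of `x′ ↦ Σ_y K(x′, y)μ(y)` are `Σ_y [iterD K(·, y)](x′) μ(y)`.
[cite: Balaban1984PropagatorsII, p.246 «derivatives of H′_j up to third order» (typing ours)] [folklore] -/
theorem iterD_kernel : ∀ (m : ℕ) (νs : Fin m → Fin d) (K : Tor (fine n M) → Tor M → ℂ) (μf : Tor M → ℂ),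
    iterD n M m νs (fun x => ∑ y, K x y * μf y) = fun x => ∑ y, iterD n M m νs (fun x' => K x' y) x * μf y
  | 0, νs, K, μf => rfl
  | m + 1, νs, K, μf => by
      rw [iterD_succ, iterD_kernel m (Fin.tail νs) K μf]
      funext x
      simp_rw [iterD_succ, sdiff_mulVec]
      rw [← Finset.sum_sub_distrib, Finset.mul_sum]
      refine Finset.sum_congr rfl fun y _ => ?_
      ring

/-- THE KERNEL OF `∂_{ν₀}⋯∂_{ν_{m−1}}H′_j` in momentum form:
`dker νs x′ y = |T₁|⁻¹ Σ_{(l,p′)} e^{i(p′+l)·x′} · Π_i ∂_{ν_i}(p′+l) · e^{−ip′·y} · h′_l(p′)`.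
[cite: Balaban1984PropagatorsII, (2.132) p.246 (momentum display; derivative symbols (1.31) of paper I; reading ours)] [folklore] -/
def dker {m : ℕ} (νs : Fin m → Fin d) (x : Tor (fine n M)) (y : Tor M) : ℂ :=
  ((Fintype.card (Tor M) : ℂ))⁻¹ *
    ∑ kq : (Fin d → Fin n) × Tor M,
      chi (fine n M) (pOf n M kq) x * (∏ i, dC n kq.1 (ofRealVec (sOf M kq.2)) (νs i)) *
        conj (chi M kq.2 y) * hP n kq.1 (ofRealVec (sOf M kq.2))

/-- order zero: `dker ∅ = hker`. [folklore] -/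
private theorem dker_zero (νs : Fin 0 → Fin d) (x : Tor (fine n M)) (y : Tor M) : dker n M νs x y = hker n M x y := by
  unfold dker hker
  congr 1
  refine Finset.sum_congr rfl fun kq _ => ?_
  rw [Fin.prod_univ_zero, mul_one]

/-- one more difference: `n·(dker (tail νs) (x′ + e_{ν₀}) y − dker (tail νs) x′ y) = dker νs x′ y` — the forward difference
acts on the fine character `e^{i(p′+l)·x′}` by the factor `n(e^{iη(p′+l)_ν} − 1) = ∂_ν(p′+l)`
(`B5Hk163TorusHolder.chi_pOf_unitVec`, `B5Block118.dSym_eq_om`, `B5Hk163Strip.dC_ofReal`). [folklore] -/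
private theorem dker_succ {m : ℕ} (νs : Fin (m + 1) → Fin d) (x : Tor (fine n M)) (y : Tor M) :
    (n : ℂ) * (dker n M (Fin.tail νs) (x + unitVec (fine n M) (νs 0)) y - dker n M (Fin.tail νs) x y)
      = dker n M νs x y := by
  have hterm : ∀ kq : (Fin d → Fin n) × Tor M,
      (n : ℂ) * (chi (fine n M) (pOf n M kq) (x + unitVec (fine n M) (νs 0)) *
              (∏ i, dC n kq.1 (ofRealVec (sOf M kq.2)) (Fin.tail νs i)) * conj (chi M kq.2 y) *
              hP n kq.1 (ofRealVec (sOf M kq.2))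
          - chi (fine n M) (pOf n M kq) x * (∏ i, dC n kq.1 (ofRealVec (sOf M kq.2)) (Fin.tail νs i)) *
              conj (chi M kq.2 y) * hP n kq.1 (ofRealVec (sOf M kq.2)))
        = chi (fine n M) (pOf n M kq) x * (∏ i, dC n kq.1 (ofRealVec (sOf M kq.2)) (νs i)) *
            conj (chi M kq.2 y) * hP n kq.1 (ofRealVec (sOf M kq.2)) := by
    rintro ⟨k, q⟩
    dsimp only
    rw [Fin.prod_univ_succ, chi_add_right, chi_pOf_unitVec, dC_ofReal, dSym_eq_om]
    have htail : ∀ i : Fin m, Fin.tail νs i = νs i.succ := fun i => rfl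
    simp_rw [htail]
    ring
  unfold dker
  rw [← mul_sub, ← Finset.sum_sub_distrib, mul_left_comm]
  congr 1
  rw [Finset.mul_sum]
  exact Finset.sum_congr rfl fun kq _ => hterm kq

/-- **THE KERNEL OF THE `m`-TH DERIVATIVE OF THE TYPED `H′_j` IS `dker`**: for every list of directions `νs` and all `x′, y`,
`[∂_{ν₀}⋯∂_{ν_{m−1}} hker(·, y)](x′) = dker νs x′ y`. [cite: Balaban1984PropagatorsII, p.246 «derivatives of H′_j up to third order» (typing ours)] [folklore] -/
theorem iterD_hker : ∀ (m : ℕ) (νs : Fin m → Fin d) (x : Tor (fine n M)) (y : Tor M),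
    iterD n M m νs (fun x' => hker n M x' y) x = dker n M νs x y
  | 0, νs, x, y => by rw [iterD_zero, dker_zero]
  | m + 1, νs, x, y => by
      rw [iterD_succ, sdiff_mulVec, iterD_hker m (Fin.tail νs) (x + unitVec (fine n M) (νs 0)) y,
        iterD_hker m (Fin.tail νs) x y, dker_succ]

/-- `[∂_{ν₀}⋯∂_{ν_{m−1}}(H′_jμ)](x′) = Σ_y dker νs x′ y · μ(y)`. [cite: Balaban1984PropagatorsII, p.246 «derivatives of H′_j up to third order» (typing ours)] [folklore] -/
theorem iterD_HpOp_mulVec {m : ℕ} (νs : Fin m → Fin d) (μf : Tor M → ℂ) (x : Tor (fine n M)) :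
    iterD n M m νs (HpOp n M *ᵥ μf) x = ∑ y : Tor M, dker n M νs x y * μf y := by
  have h : (HpOp n M *ᵥ μf) = fun x => ∑ y, hker n M x y * μf y := funext (HpOp_mulVec n M μf)
  rw [h, iterD_kernel]
  exact Finset.sum_congr rfl fun y _ => by rw [iterD_hker]

/-- THE DERIVATIVE KERNEL BETWEEN A BLOCK POINT AND A COARSE POINT as the torus momentum sum of the derivative fine-offset
multiplier: `gkerD a νs z = |T₁|⁻¹ Σ_{p′} e^{ip′·z} G′_{a;ν}(p′)`, `G′_{a;ν} = B6Hprime2132Holder.GHD n a νs`. [folklore] -/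
def gkerD (a : Fin d → Fin n) {m : ℕ} (νs : Fin m → Fin d) (z : Tor M) : ℂ :=
  ((Fintype.card (Tor M) : ℂ))⁻¹ * ∑ q : Tor M, chi M q z * GHD n a νs (ofRealVec (sOf M q))

/-- **THE DICTIONARY FOR THE DERIVATIVES**: `dker νs (n·y′ + a) y = gkerD a νs (y′ − y)`.
[cite: Balaban1984PropagatorsII, (2.132) p.246 (momentum display; torus reading ours, momenta (1.29) of paper I p.23)] [folklore] -/
theorem dker_bpt {m : ℕ} (νs : Fin m → Fin d) (y' : Tor M) (a : Fin d → Fin n) (y : Tor M) :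
    dker n M νs (bpt n M y' a) y = gkerD n M a νs (y' - y) := by
  unfold dker gkerD GHD
  congr 1
  rw [Fintype.sum_prod_type, Finset.sum_comm]
  refine Finset.sum_congr rfl fun q _ => ?_
  rw [Finset.mul_sum]
  refine Finset.sum_congr rfl fun k _ => ?_
  dsimp only
  rw [bpt, chi_add_right, chi_pOf_up, ← phase163_sOf, conj_chi, chi_neg_comm, sub_eq_add_neg, chi_add_right]
  ring

end Deriv

section DerivKernel

variable (n : ℕ) [NeZero n] (M : Fin (d + 1) → ℕ) [hM : ∀ μ, NeZero (M μ)]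

/-- **THE DERIVATIVE KERNEL IS THE TORUS KERNEL OF `G′_{a;ν}`** (`m ≤ 3`): at a lattice representative `x`,
`gkerD a νs x̄ = B4TorusKernel.MultiPeriod.torusKernel (descendC G′_{a;ν}) M x`.
[cite: Balaban1984PropagatorsII, p.246, sentence after (2.132) (torus reading ours)] [folklore] -/
theorem gkerD_toT_eq_torusKernel (a : Fin (d + 1) → Fin n) {m : ℕ} (νs : Fin m → Fin (d + 1)) (hm : m ≤ 3)
    (x : Fin (d + 1) → ℤ) :
    gkerD n M a νs (toT M x)
      = torusKernel (descendC (fun p : Fin (d + 1) → ℂ => GHD n a νs p)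
          (stripRegular_GHD n (kappaN_pos _).le le_rfl a νs hm) (kappaN_pos _).le) M x :=
  momentumSum_toT_eq_torusKernel M (stripRegular_GHD n (kappaN_pos _).le le_rfl a νs hm) (kappaN_pos _).le x

/-- **«DERIVATIVES OF H′_j UP TO THIRD ORDER … ARE UNIFORMLY BOUNDED AND HAVE A UNIFORM EXPONENTIAL DECAY WITH A DECAY RATE
DEPENDING ON d ONLY» FOR THE TYPED TORUS OPERATOR**: for every period vector `M` (all `M_i ≥ 1`), `n ≥ 1`, `m ≤ 3`
directions `νs`, fine offset `a` and lattice representatives `x′, x`,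
`|[∂_{ν₀}⋯∂_{ν_{m−1}}H′_j](n·x̄′ + a, x̄)| ≤ MGHD(d+1, m) · periodConst(κ_N(d+1), d) · e^{−(κ_N(d+1)/(d+1))|x′ − x|_{T,∞}}`
(`B6Hprime2132Holder.torusKernel_GHD_decay` BY NAME). [cite: Balaban1984PropagatorsII, p.246, sentence after (2.132)] [folklore] -/
theorem norm_dker_le (a : Fin (d + 1) → Fin n) {m : ℕ} (νs : Fin m → Fin (d + 1)) (hm : m ≤ 3)
    (x' x : Fin (d + 1) → ℤ) :
    ‖dker n M νs (bpt n M (toT M x') a) (toT M x)‖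
      ≤ MGHD (d + 1) m * periodConst (kappaN (d + 1)) d *
          Real.exp (-(kappaN (d + 1) / (d + 1) * torusSupNorm M (x' - x))) := by
  rw [dker_bpt, toT_sub, gkerD_toT_eq_torusKernel n M a νs hm]
  exact torusKernel_GHD_decay n a νs hm (one_le_M M) (x' - x)

/-- **«AND THEIR LOCAL HÖLDER NORMS AS IN (2.67)» FOR THE TYPED TORUS OPERATOR**: for every period vector `M`, `n ≥ 1`,
`m ≤ 3` directions, `0 ≤ α < 1`, two fine offsets `a, ã` of the same block with `|a_ν − ã_ν| ≤ δ` (`δ ≥ 0`) and lattice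
representatives `x′, x`,
`|[∂^mH′_j](n·x̄′ + a, x̄) − [∂^mH′_j](n·x̄′ + ã, x̄)| ≤ 2e^{d+2}(d+2)·C′(d+1,m,α)·(δ/n)^α · periodConst(κ_N(d+1), d) ·
e^{−(κ_N(d+1)/(d+1))|x′ − x|_{T,∞}}` — with `δ = |a − ã|_∞` the local Hölder quotient of exponent `α` in the physical
distance `|ηa − ηã|_∞ = δ/n`, uniformly bounded with the `d`-only decay rate (`B6Hprime2132HolderKernel.torusKernel_GHD_holder`
BY NAME). [cite: Balaban1984PropagatorsII, p.246, sentence after (2.132); (2.67) p.234] [folklore] -/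
theorem norm_dker_sub_le (a a' : Fin (d + 1) → Fin n) {δ : ℝ} (hδ0 : 0 ≤ δ)
    (hδ : ∀ ν, |((a ν : ℕ) : ℝ) - ((a' ν : ℕ) : ℝ)| ≤ δ) {m : ℕ} (νs : Fin m → Fin (d + 1)) (hm : m ≤ 3)
    {α : ℝ} (hα0 : 0 ≤ α) (hα1 : α < 1) (x' x : Fin (d + 1) → ℤ) :
    ‖dker n M νs (bpt n M (toT M x') a) (toT M x) - dker n M νs (bpt n M (toT M x') a') (toT M x)‖
      ≤ 2 * Real.exp 1 ^ (d + 2) * ((d : ℝ) + 2) * CHolder2132 (d + 1) m α * (δ / n) ^ α *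
          periodConst (kappaN (d + 1)) d * Real.exp (-(kappaN (d + 1) / (d + 1) * torusSupNorm M (x' - x))) := by
  rw [dker_bpt, dker_bpt, toT_sub, gkerD_toT_eq_torusKernel n M a νs hm, gkerD_toT_eq_torusKernel n M a' νs hm]
  exact torusKernel_GHD_holder n a a' hδ0 hδ νs hm hα0 hα1 (one_le_M M) (x' - x)

/-- operator form of the derivative bound: `|[∂^m(H′_jμ)](n·x̄′ + a)| ≤ MGHD·periodConst·Σ_y e^{−(κ_N/(d+1))|x′−y|_{T,∞}}|μ(ȳ)|`
for any family of lattice representatives `r` of the coarse torus. [cite: Balaban1984PropagatorsII, p.246, sentence after (2.132)] [folklore] -/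
theorem norm_iterD_HpOp_mulVec_le (μf : Tor M → ℂ) (a : Fin (d + 1) → Fin n) {m : ℕ} (νs : Fin m → Fin (d + 1))
    (hm : m ≤ 3) (x' : Fin (d + 1) → ℤ) (r : Tor M → (Fin (d + 1) → ℤ)) (hr : ∀ y, toT M (r y) = y) :
    ‖iterD n M m νs (HpOp n M *ᵥ μf) (bpt n M (toT M x') a)‖
      ≤ MGHD (d + 1) m * periodConst (kappaN (d + 1)) d *
          ∑ y : Tor M, Real.exp (-(kappaN (d + 1) / (d + 1) * torusSupNorm M (x' - r y))) * ‖μf y‖ := by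
  rw [iterD_HpOp_mulVec, Finset.mul_sum]
  refine (norm_sum_le _ _).trans (Finset.sum_le_sum fun y _ => ?_)
  rw [norm_mul, ← mul_assoc]
  refine mul_le_mul_of_nonneg_right ?_ (norm_nonneg _)
  have h := norm_dker_le n M a νs hm x' (r y)
  rw [hr y] at h
  exact h

/-- operator form of the local Hölder bound: for two fine points `n·x̄′ + a`, `n·x̄′ + ã` of the same block,
`|[∂^m(H′_jμ)](n·x̄′+a) − [∂^m(H′_jμ)](n·x̄′+ã)| ≤ 2e^{d+2}(d+2)C′(d+1,m,α)(δ/n)^α·periodConst·Σ_y e^{−(κ_N/(d+1))|x′−y|_{T,∞}}|μ(ȳ)|`.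
[cite: Balaban1984PropagatorsII, p.246, sentence after (2.132)] [folklore] -/
theorem norm_iterD_HpOp_mulVec_sub_le (μf : Tor M → ℂ) (a a' : Fin (d + 1) → Fin n) {δ : ℝ} (hδ0 : 0 ≤ δ)
    (hδ : ∀ ν, |((a ν : ℕ) : ℝ) - ((a' ν : ℕ) : ℝ)| ≤ δ) {m : ℕ} (νs : Fin m → Fin (d + 1)) (hm : m ≤ 3)
    {α : ℝ} (hα0 : 0 ≤ α) (hα1 : α < 1) (x' : Fin (d + 1) → ℤ) (r : Tor M → (Fin (d + 1) → ℤ))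
    (hr : ∀ y, toT M (r y) = y) :
    ‖iterD n M m νs (HpOp n M *ᵥ μf) (bpt n M (toT M x') a) - iterD n M m νs (HpOp n M *ᵥ μf) (bpt n M (toT M x') a')‖
      ≤ 2 * Real.exp 1 ^ (d + 2) * ((d : ℝ) + 2) * CHolder2132 (d + 1) m α * (δ / n) ^ α *
          periodConst (kappaN (d + 1)) d *
          ∑ y : Tor M, Real.exp (-(kappaN (d + 1) / (d + 1) * torusSupNorm M (x' - r y))) * ‖μf y‖ := by
  rw [iterD_HpOp_mulVec, iterD_HpOp_mulVec, ← Finset.sum_sub_distrib, Finset.mul_sum]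
  refine (norm_sum_le _ _).trans (Finset.sum_le_sum fun y _ => ?_)
  rw [← sub_mul, norm_mul, ← mul_assoc]
  refine mul_le_mul_of_nonneg_right ?_ (norm_nonneg _)
  have h := norm_dker_sub_le n M a a' hδ0 hδ νs hm hα0 hα1 x' (r y)
  rw [hr y] at h
  exact h

end DerivKernel

end

end Literature.MathematicalPhysics.QuantumFieldTheory.Balaban1983to89.B6Hprime2132Torus
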